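import Summits.BirchSwinnertonDyer.BirchSwinnertonDyer.Theorems.ResidualThetaTransportAtTwoSignedMuVanishingAtTwoPlusSel2
import Literature.NumberTheory.EllipticCurves.FineSelmerClassGroupCriterion

/-!
# Line `fine-plus-split` for crux `SignedMuSeedAtTwoPlus` (stmt-BirchSwinnertonDyer-21438) — crux-ideate r1 k2

FINE + PLUS-LOCAL SPLITTING. `Sel₀(ℚ_∞, A[2^∞]) ∩ Sel⁺ ⊆ Sel⁺(A/ℚ_∞)` inside `H¹(ℚ_∞, A[2^∞])`, so
`Sel⁺[2]` is finite as soon as (F) `Sel₀[2]` is finite — statement (A) of Coates–Sujatha at `(A, 2)`, `X₀` f.g.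
over `ℤ₂` — and (L) the image of `Sel⁺[2]` in `H¹/Sel₀` is finite (`μ` of `ker(X⁺ ↠ X₀) = Λ/Col⁺(ξ)Λ`,
`ξ` a generator of `H¹_Iw(ℚ_S/ℚ, T₂A) ≅ Λ`; Kurihara–Pollack 2007 Prop. 3.4 read mod `2`). The fine half (F) is
one tree fact away from CLASSICAL Iwasawa theory of the CUBIC `2`-division field `L_W = ℚ(x(P))` — a CLASS
INVARIANT (all mod-`2` congruent members share `L_W`): Lim 2017 Thm 3.5 at two
(`Lim2017.thm35_at_two_fineSelmerDual_moduleFinite_of_classicalMuVanishes_of_le_divisionField_four`, `L ⊆ ℚ(E[4])`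
of `2`-power index) with `μ₂(L_W^{cyc}) = 0`, certified per class by `h(L_W)` odd (Iwasawa 1956: `2` is totally
ramified in `L_W` for a habitat⁺ class) or by a Fukuda door (`fukuda1994_thm1_…`, tree). The plus-local half (L)
is the residue. `Δ_W < 0` makes the real place cohomologically invisible for `W[2]` (complex conjugation is a
transposition: `Ĥ^*(ℝ, W[2]) = 0`), which is what lets the `cd₂ = 2` formalism run at `p = 2`.
The `∀ W` half is per-class decidable on (F) and conjecture-strength uniformly — BSD is not proved by any of this.
-/

open WeierstrassCurve Literature.NumberTheory.EllipticCurves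
open Literature.NumberTheory.EllipticCurves.Kobayashi2003
open Literature.NumberTheory.EllipticCurves.Rank1Residual
open Literature.NumberTheory.IwasawaTheory
open Summit.BirchSwinnertonDyer.BirchSwinnertonDyer.Theses.ResidualThetaTransportAtTwo

noncomputable section

namespace Summit.BirchSwinnertonDyer.BirchSwinnertonDyer.Cruxes.SignedMuSeedAtTwoPlus.FinePlusSplit

/-- Statement (A) at `(A, 2)` (tree spelling). -/
def FineMuZeroAtTwo (A : WeierstrassCurve ℚ) [A.IsElliptic] : Prop :=
  ∀ (κ : ZpExtension ℚ 2), κ.IsCyclotomic →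
    ∃ (γ : Field.absoluteGaloisGroup ℚ) (D : A.FineSelmerDualData κ γ),
      Module.Finite ℤ_[2] (RestrictScalars ℤ_[2] (IwasawaAlgebra 2) D.X)

/-- The cubic-field class-group door (hypothesis of Lim 2017 Thm 3.5 at two). -/
def CubicDoor (A : WeierstrassCurve ℚ) [A.IsElliptic] : Prop :=
  ∃ L : IntermediateField ℚ (AlgebraicClosure ℚ), L ≤ A.divisionField 4 ∧
    (∃ k : ℕ, Module.finrank ℚ (A.divisionField 4) = 2 ^ k * Module.finrank ℚ L) ∧
    ∀ κL : ZpExtension L 2, κL.IsCyclotomic → ClassicalMuVanishes κL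

/-- The plus-local half at `κ`: the image of `Sel⁺(A/ℚ_∞)[2]` in `H¹(ℚ_∞, A[2^∞]) / Sel₀(ℚ_∞, A[2^∞])` is finite. -/
def PlusLocalHalf (A : WeierstrassCurve ℚ) [A.IsElliptic] (κ : ZpExtension ℚ 2) : Prop :=
  ((QuotientAddGroup.mk' (A.fineSelmerInfty κ)) ''
    {x : A.subgroupH1 2 κ.kerSubgroup | x ∈ signedSelmerInfty A κ 1 ∧ 2 • x = 0}).Finite

/-! ## Registered stub statements (named `Prop`s; each `stub_*` proves its statement BY NAME) -/

/-- **Stub statement 1 (size L, literature): Lim 2017 Thm 3.5 with Lemma 3.2 at `p = 2` for `E/ℚ`, restricted to the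
door** (Poitou–Tate over `L^{cyc}`, Iwasawa's `H²`-vanishing from `μ_class = 0`, `cd₂` bookkeeping with `μ₄ ⊂ ℚ(E[4])`,
Nakayama, descent along the `2`-extension `ℚ(E[4])/L` and corestriction to `ℚ`). Equivalently: give the tree fact
`Lim2017.thm35_at_two_…` a `_holds`. -/
def FineHalfOfCubicDoor : Prop :=
  ∀ (A : WeierstrassCurve ℚ) [A.IsElliptic], CubicDoor A → FineMuZeroAtTwo A

/-- **Stub statement 2 (size M, the structural claim): fine half + plus-local half ⟹ `Sel⁺(A/ℚ_∞)[2]` finite** — exact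
sequence `0 → Sel₀[2] → Sel⁺[2] → H¹/Sel₀` (`Kobayashi2003.fineSelmerInfty_le_signedSelmerInfty`); `Sel₀[2]` is finite
because `X₀` is f.g. over `ℤ₂` (`FineSelmerDualData.isDualPair`, any `γ`). -/
def SplitFiniteness : Prop :=
  ∀ (A : WeierstrassCurve ℚ) [A.IsElliptic] (κ : ZpExtension ℚ 2) (γ : Field.absoluteGaloisGroup ℚ),
    κ.IsCyclotomic → κ.IsTopGenerator γ → FineMuZeroAtTwo A → PlusLocalHalf A κ →
    {s : signedSelmerInfty A κ 1 | 2 • s = 0}.Finite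

/-- **Stub statement 3 (certificate existence; (F) per class a class-number computation, (L) the residue; uniformly
conjecture-strength):** every habitat⁺ curve is congruent mod `2` to an admissible `A` carrying the cubic door (a class
invariant) and the plus-local half at every cyclotomic `κ`. -/
def SplitCertificate : Prop :=
  ∀ (W : WeierstrassCurve ℚ) [W.IsElliptic] [W.IsGloballyMinimal], ¬ W.HasCM → W.analyticRank = 0 →
    GoodSS W 2 → W.frobeniusTrace 2 = 0 → W.Δ < 0 →
    ∃ (A : WeierstrassCurve ℚ) (_ : A.IsElliptic) (_ : A.IsGloballyMinimal), GoodSS A 2 ∧ A.frobeniusTrace 2 = 0 ∧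
      (∃ e : WeierstrassCurve.geomTorsion W (2 : ℤ) ≃+ WeierstrassCurve.geomTorsion A (2 : ℤ),
        ∀ (σ : Field.absoluteGaloisGroup ℚ) (P : WeierstrassCurve.geomTorsion W (2 : ℤ)), e (σ • P) = σ • e P) ∧
      CubicDoor A ∧ ∀ (κ : ZpExtension ℚ 2), κ.IsCyclotomic → PlusLocalHalf A κ

theorem stub_fineHalfOfCubicDoor : FineHalfOfCubicDoor := by
  sorry

theorem stub_splitFiniteness : SplitFiniteness := by
  sorry

theorem stub_splitCertificate : SplitCertificate := by
  sorry

/-! ## Assembly (sorry-free glue) and the registrar theorem -/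

/-- GLUE (no sorry): the three stub statements give the crux through the SEL2-seed door (p580570). -/
theorem SignedMuSeedAtTwoPlus_of_stubs (hF : FineHalfOfCubicDoor) (hS : SplitFiniteness) (hC : SplitCertificate) :
    SignedMuSeedAtTwoPlus := by
  refine Theorems.SignedMuAtTwo.signedMuSeedAtTwoPlus_of_sel2Seed ?_
  intro W _ _ hCM hr hss ha hΔ
  obtain ⟨A, hA, hA', hssA, haA, hiso, hdoor, hloc⟩ := hC W hCM hr hss ha hΔ
  exact ⟨A, hA, hA', hssA, haA, hiso, fun κ γ hκ hγ _ ↦ hS A κ γ hκ hγ (hF A hdoor) (hloc κ hκ)⟩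

/-- **THE SKELETON THEOREM (registrar shape): the crux BY NAME from the declared stubs**; the only `sorry`s in its
closure are the three `stub_*` theorems. -/
theorem SignedMuSeedAtTwoPlus_of :
    Summit.BirchSwinnertonDyer.BirchSwinnertonDyer.Theses.ResidualThetaTransportAtTwo.SignedMuSeedAtTwoPlus :=
  SignedMuSeedAtTwoPlus_of_stubs stub_fineHalfOfCubicDoor stub_splitFiniteness stub_splitCertificate

/-- Bonus (no sorry): stub 1 is exactly the tree's named fact (Lim 2017 Thm 3.5 at two) restricted to the door. -/
theorem fineHalfOfCubicDoor_of_lim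
    (hLim : Lim2017.thm35_at_two_fineSelmerDual_moduleFinite_of_classicalMuVanishes_of_le_divisionField_four) :
    FineHalfOfCubicDoor := by
  intro A _ hdoor κ hκ
  obtain ⟨L, hL, hk, hμ⟩ := hdoor
  exact hLim A L hL hk hμ κ hκ

end Summit.BirchSwinnertonDyer.BirchSwinnertonDyer.Cruxes.SignedMuSeedAtTwoPlus.FinePlusSplit

end
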